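import Summits.QuantumAdvantage.AdviceFreeQNC0.AffBells35WRELTwins

/-!
# qa-qnc0-p1 g35 — `PolyLossOfWREL` and the wired-elimination line, part 7/7: single private coins, toggles, input forms

Continuation of `AffBells35WRELTwins`.

Ported to the tree VERBATIM (split into seven files `AffBells35PolyLossOfWREL` / `AffBells35WREL{Firing,Quiet,Typical,Structure,Twins,Toggle}` for the 400-line rule; lint fixes only: `push Not`, `card_filter_add_card_filter_not`, unused simp arguments, two `_`-binders) by the prover seat qn-prover-3 g20 at the ask of planner qa-qnc0-p1 g36 (INBOX 11:15Z: exp35/WREL35.lean FROZEN, 1891 l., farm rc 0 / 0 sorry); authored and proved by the planner seat qa-qnc0-p1 g35.  Serves the crux stmt-QuantumAdvantage-22907 (route DWalkThree); untagged (the gate refuses `--supports` across sub-problems on AdviceFreeQNC0/ targets).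
-/

noncomputable section
open Classical

namespace Summit.QuantumAdvantage.AdviceFreeQNC0.AffBells35

open Finset Literature.Computability.QuantumComplexity Literature.Computability.QuantumComplexity.RingHLF
open AffBells23 Fib19 AffBells26 AffBells29

variable {N : ℕ}

section SinglePrivate

open AffBells33 AffBells28 AffBells28lit

variable {Z K : ℕ}

/-- `singlePrivate_endgame` (planner qa-qnc0-p1 g35, exp35/WREL35.lean; see the section header above). -/
theorem singlePrivate_endgame : ∀ δ a r : ZMod 3, δ ≠ 0 → a ≠ 0 → ∀ α β : Fin 2,
    (α.val + (if (0 : ZMod 3) = r then 1 else 0)) % 2 = (β.val + (if (0 : ZMod 3) + δ = r then 1 else 0)) % 2 →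
    (α.val + (if a + 0 = r then 1 else 0)) % 2 = (β.val + (if a + 0 + δ = r then 1 else 0)) % 2 →
    (r = 0 ∧ a = 2 * δ) ∨ (r = δ ∧ a = δ) := by
  decide

/-- **L3b — LINK RIGIDITY (ROUND-34 §12.12(v)(11)).**  An active reader `h` of coin `t₀` with exactly the information of ONE coin `t₂`
unread by the other active readers of `t₀` (free coin `t₁` present) is rigid on a perfect fibre: either `r_h = 0` and the private
coefficient is `2δ`, or `r_h = δ` and the private coefficient is `δ` (`δ = P h t₀`).  These are the links of a wire. -/
theorem singlePrivate (P : Fin K → Fin Z → ZMod 3) (r : Fin K → ZMod 3) (τ : ℕ) {t₀ t₁ t₂ : Fin Z}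
    (h01 : t₀ ≠ t₁) (h02 : t₀ ≠ t₂) (h12 : t₁ ≠ t₂)
    (hfree : ∀ b, P b t₁ = 0) {h : Fin K} (hδ : P h t₀ ≠ 0) (ha : P h t₂ ≠ 0)
    (hpriv : ∀ b, b ≠ h → P b t₀ ≠ 0 → P b t₂ = 0)
    (hperf : ∀ y : Fin Z → Bool, AffBells33.onesCard y % 2 = 0 → testCount P r τ y % 2 = 0) :
    (r h = 0 ∧ P h t₂ = 2 * P h t₀) ∨ (r h = P h t₀ ∧ P h t₂ = P h t₀) := by
  set A := (univ.filter fun b => b ≠ h ∧ (P b t₀ ≠ 0 ∧ (0 : ZMod 3) = r b)).card with hA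
  set B := (univ.filter fun b => b ≠ h ∧ (P b t₀ ≠ 0 ∧ (0 : ZMod 3) + P b t₀ = r b)).card with hB
  have step : ∀ y : Fin Z → Bool, AffBells33.onesCard y % 2 = 0 → y t₀ = false →
      (∀ b, b ≠ h → P b t₀ ≠ 0 → tsum P y b = 0) →
      (A + (if tsum P y h = r h then 1 else 0)) % 2 = (B + (if tsum P y h + P h t₀ = r h then 1 else 0)) % 2 := by
    intro y hy hy0 hyH
    have hy' : AffBells33.onesCard (wflip t₀ t₁ y) % 2 = 0 := by rw [onesCard_wflip h01 y hy0]; exact hy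
    have hw := windowFlip_count P r τ h01 hfree y hy0 (by rw [hperf y hy, hperf _ hy'])
    rw [card_filter_split_one (fun b => P b t₀ ≠ 0 ∧ tsum P y b = r b) h,
      card_filter_split_one (fun b => P b t₀ ≠ 0 ∧ tsum P y b + P b t₀ = r b) h] at hw
    have hL : (univ.filter fun b => b ≠ h ∧ (P b t₀ ≠ 0 ∧ tsum P y b = r b)) =
        univ.filter fun b => b ≠ h ∧ (P b t₀ ≠ 0 ∧ (0 : ZMod 3) = r b) := by
      ext b
      simp only [mem_filter, mem_univ, true_and]
      constructor
      · rintro ⟨hb, h0, h1⟩; exact ⟨hb, h0, by rw [← h1, hyH b hb h0]⟩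
      · rintro ⟨hb, h0, h1⟩; exact ⟨hb, h0, by rw [hyH b hb h0, h1]⟩
    have hR : (univ.filter fun b => b ≠ h ∧ (P b t₀ ≠ 0 ∧ tsum P y b + P b t₀ = r b)) =
        univ.filter fun b => b ≠ h ∧ (P b t₀ ≠ 0 ∧ (0 : ZMod 3) + P b t₀ = r b) := by
      ext b
      simp only [mem_filter, mem_univ, true_and]
      constructor
      · rintro ⟨hb, h0, h1⟩; exact ⟨hb, h0, by rw [← h1, hyH b hb h0]⟩
      · rintro ⟨hb, h0, h1⟩; exact ⟨hb, h0, by rw [hyH b hb h0, h1]⟩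
    rw [hL, hR] at hw
    have h1 : (if (P h t₀ ≠ 0 ∧ tsum P y h = r h) then 1 else 0) = (if tsum P y h = r h then 1 else 0) := by
      simp [hδ]
    have h2 : (if (P h t₀ ≠ 0 ∧ tsum P y h + P h t₀ = r h) then 1 else 0) =
        (if tsum P y h + P h t₀ = r h then 1 else 0) := by
      simp [hδ]
    rw [h1, h2] at hw
    exact hw
  have oth0 : ∀ b, b ≠ h → P b t₀ ≠ 0 → tsum P (fun _ => false) b = 0 := fun b _ _ => tsum_zeroY P b
  have oth2 : ∀ b, b ≠ h → P b t₀ ≠ 0 → tsum P (pairY t₂ t₁) b = 0 := by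
    intro b hb h0; rw [tsum_pairY P h12.symm, hpriv b hb h0, hfree b, add_zero]
  have e0 := step (fun _ => false) onesCard_zeroY rfl oth0
  have e2 := step (pairY t₂ t₁) (onesCard_pairY h12.symm) (pairY_apply_of_ne h02 h01) oth2
  rw [tsum_zeroY] at e0
  rw [tsum_pairY P h12.symm, hfree h] at e2
  have hα : A % 2 < 2 := Nat.mod_lt _ two_pos
  have hβ : B % 2 < 2 := Nat.mod_lt _ two_pos
  refine singlePrivate_endgame (P h t₀) (P h t₂) (r h) hδ ha ⟨A % 2, hα⟩ ⟨B % 2, hβ⟩ ?_ ?_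
  · simp only []; omega
  · simp only []; omega

end SinglePrivate


section Toggle

/-- **Activity toggle (STEP 2 entry point, ROUND-34 §12.12(v)(12)(b)).**  Deactivating position `d` of the kernel line — valid when `d`
and both its neighbours are ones — is realised on inputs by flipping the two NEIGHBOURING bits (the forced bits `x_{d±1} = J_{d±1∓1} ⊕ J_d`
flip, `apply_eq_of_kline`); the result is odd and its kernel line is `J` with `d` switched off. -/
theorem kline_toggle_off (hN : 3 ≤ N) (x : Fin N → Bool) (hodd : IsOdd x) (d : Fin N)
    (hp : kline x (prv d) = true) (hd : kline x d = true) (hn : kline x (nxt d) = true) :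
    IsOdd (flipAt x {prv d, nxt d}) ∧ kline (flipAt x {prv d, nxt d}) = Function.update (kline x) d false := by
  have hpn : prv d ≠ nxt d := prv_ne_nxt hN d
  have hnd : nxt d ≠ d := fun h =>
    prv_ne_nxt hN d ((by have := congrArg prv h; rw [prv_nxt] at this; exact this.symm : prv d = d).trans h.symm)
  have hpd : prv d ≠ d := fun h =>
    prv_ne_nxt hN d (h.trans (by have := congrArg nxt h; rw [nxt_prv] at this; exact this))
  have hppd : prv (prv d) ≠ d := by
    intro h; have := prv_ne_nxt hN (prv d); rw [nxt_prv] at this; exact this h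
  have hnnd : nxt (nxt d) ≠ d := by
    intro h; have := prv_ne_nxt hN (nxt d); rw [prv_nxt] at this; exact this h.symm
  have hodd' : IsOdd (flipAt x {prv d, nxt d}) :=
    (isOdd_flipAt_of_even x _ (by rw [card_pair hpn])).2 hodd
  refine ⟨hodd', ?_⟩
  have hHC := (kline_hardCore hN x hodd).1
  set J := kline x with hJ
  have hJ'ne : Function.update J d false ≠ fun _ => false := by
    intro h
    have := congrFun h (prv d)
    rw [Function.update_of_ne hpd, hp] at this
    exact absurd this (by decide)
  rw [kline_eq_iff_inKernel hN _ hodd' hJ'ne]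
  have hv' : ∀ i : Fin N, ¬ (Function.update J d false i = false ∧ Function.update J d false (nxt i) = false) := by
    intro i
    by_cases hi : i = d
    · subst hi; rw [Function.update_of_ne hnd, hn]; simp
    · by_cases hi' : nxt i = d
      · have hip : i = prv d := by rw [← hi', prv_nxt]
        rw [Function.update_of_ne hi, hip, hp]; simp
      · rw [Function.update_of_ne hi, Function.update_of_ne hi']; exact hHC i
  rw [inKernel_iff_forced _ hv']
  have hx := (inKernel_iff_forced J hHC x).1 (kline_inKernel hN x hodd)
  intro b hb
  by_cases hbd : b = d
  · subst hbd; rw [Function.update_self] at hb; exact absurd hb (by decide)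
  rw [Function.update_of_ne hbd] at hb
  by_cases hbp : b = prv d
  · subst hbp
    rw [flipAt_apply_of_mem (by simp), hx _ hb, nxt_prv, Function.update_of_ne hppd, Function.update_self, hd]
    cases J (prv (prv d)) <;> decide
  by_cases hbn : b = nxt d
  · subst hbn
    rw [flipAt_apply_of_mem (by simp), hx _ hb, prv_nxt, Function.update_of_ne hnnd, Function.update_self, hd]
    cases J (nxt (nxt d)) <;> decide
  have h1 : prv b ≠ d := fun h => hbn (by rw [← h, nxt_prv])
  have h2 : nxt b ≠ d := fun h => hbp (by rw [← h, prv_nxt])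
  rw [flipAt_apply_of_not_mem (by simp [hbp, hbn]), hx _ hb, Function.update_of_ne h1, Function.update_of_ne h2]

/-- the toggled input agrees with `x` off the two neighbours of `d`. -/
theorem toggle_apply_of_ne (x : Fin N → Bool) (d i : Fin N) (h1 : i ≠ prv d) (h2 : i ≠ nxt d) :
    flipAt x {prv d, nxt d} i = x i :=
  flipAt_apply_of_not_mem (by simp [h1, h2])

end Toggle


section InputForm

open AffBells28 AffBells28lit

/-- **WINDOW-FLIP LEMMA, INPUT FORM (ROUND-34 §12.12(v)(13) — the form that composes with activity toggles).**  On a perfect fibre,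
flipping a coin `i₀` together with a FREE coin `i₁` keeps the fibre (`kline_flipPair`) and is pass-parity-neutral on the active rows reading
`i₀`: every other active row sees the same form (it reads neither flipped coin), and the total active pass count has the parity dictated
by `targetFormula` at both points. -/
theorem windowFlip_input (hN : 3 ≤ N) (β : Fin N → Fin N → ZMod 3) (c : Fin N → ZMod 3) (x : Fin N → Bool)
    (hodd : IsOdd x) (hperf : PerfectFibre β c (kline x)) {i₀ i₁ : Fin N} (h01 : i₀ ≠ i₁)
    (hi0 : kline x i₀ = false) (hi1 : kline x i₁ = false) (hfree : ∀ b, kline x b = true → β b i₁ = 0) :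
    (univ.filter fun b => kline x b = true ∧ β b i₀ ≠ 0 ∧ affBell β c x b = true).card % 2 =
      (univ.filter fun b => kline x b = true ∧ β b i₀ ≠ 0 ∧ affBell β c (flipAt x {i₀, i₁}) b = true).card % 2 := by
  obtain ⟨hodd', hk'⟩ := kline_flipPair hN x hodd h01 hi0 hi1
  set x' := flipAt x {i₀, i₁} with hx'
  -- target formula at both points
  have h1 := (targetFormula N hN x hodd (affBell β c x)).1 (hperf x hodd rfl)
  have h2 := (targetFormula N hN x' hodd' (affBell β c x')).1 (hperf x' hodd' hk')
  rw [hk'] at h2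
  -- split the active pass counts along `β b i₀ ≠ 0`
  have hsplit : ∀ w : Fin N → Bool, activeOnes x' w = activeOnes x w := by
    intro w; unfold activeOnes; rw [hk']
  rw [hsplit] at h2
  have hdec : ∀ w : Fin N → Bool, activeOnes x w =
      (univ.filter fun b => kline x b = true ∧ β b i₀ ≠ 0 ∧ w b = true).card +
      (univ.filter fun b => kline x b = true ∧ β b i₀ = 0 ∧ w b = true).card := by
    intro w
    unfold activeOnes
    rw [← card_filter_add_card_filter_not (p := fun b => β b i₀ ≠ 0), filter_filter, filter_filter]
    congr 1
    · congr 1; ext b; simp only [mem_filter, mem_univ, true_and]; tauto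
    · congr 1; ext b; simp only [mem_filter, mem_univ, true_and, not_not]; tauto
  rw [hdec] at h1 h2
  -- the non-readers of `i₀` see the same bell
  have hsame : (univ.filter fun b => kline x b = true ∧ β b i₀ = 0 ∧ affBell β c x' b = true) =
      univ.filter fun b => kline x b = true ∧ β b i₀ = 0 ∧ affBell β c x b = true := by
    ext b
    simp only [mem_filter, mem_univ, true_and]
    constructor
    · rintro ⟨hb, h0, hz⟩
      refine ⟨hb, h0, ?_⟩
      rw [affBell_eq_true_iff] at hz ⊢
      rw [hx', AffBells28lit.form_flipAt, sum_pair h01] at hz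
      unfold sdelta at hz
      rw [h0, hfree b hb] at hz
      simpa using hz
    · rintro ⟨hb, h0, hz⟩
      refine ⟨hb, h0, ?_⟩
      rw [affBell_eq_true_iff] at hz ⊢
      rw [hx', AffBells28lit.form_flipAt, sum_pair h01]
      unfold sdelta
      rw [h0, hfree b hb]
      simpa using hz
  rw [hsame] at h2
  omega

/-- The shift made explicit: for an active reader `b` of `i₀` (not reading the free coin), the flipped bell tests `form + sdelta b i₀ = c b`. -/
theorem affBell_windowFlip (β : Fin N → Fin N → ZMod 3) (c : Fin N → ZMod 3) (x : Fin N → Bool) {i₀ i₁ : Fin N}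
    (h01 : i₀ ≠ i₁) (b : Fin N) (hb1 : β b i₁ = 0) :
    affBell β c (flipAt x {i₀, i₁}) b = true ↔ form β x b + sdelta β x b i₀ = c b := by
  rw [affBell_eq_true_iff, AffBells28lit.form_flipAt, sum_pair h01]
  unfold sdelta
  rw [hb1]
  simp

end InputForm


end Summit.QuantumAdvantage.AdviceFreeQNC0.AffBells35
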